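import Literature.NumberTheory.EllipticCurves.FineSelmerReducibleIsotypicLayerZero
import HarnessLib

/-!
# Coates–Sujatha's Conjecture A on a REDUCIBLE row: the per-character DOOR MENU (layer-zero door L6 ∨ bounded `p`-ranks)
# and the `ℚ`-specialisation (proved; no definition, no named fact, no `sorry`)

`Proofs`-style file (theorems only) in topic `NumberTheory/EllipticCurves` (namespace
`Literature.NumberTheory.EllipticCurves.CoatesSujatha2005`), written by the prover seat `bsd-potss-rkm` g39 (cell `bsd-potss`;
item stmt-BirchSwinnertonDyer-19196 `ReducibleKatoMember`, `--supports`; closes nothing; neither Conjecture A nor BSD is proved for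
any particular curve here — the per-row door data remain hypotheses).  Sequel of `FineSelmerReducibleIsotypicLayerZero.lean`
(count form §1 + the two layer-zero count lemmas §2) and of `FineSelmerReducibleIsotypicMuRoad.lean` (rkm g38, bounded `p`-ranks).

THE THEOREM (`fineSelmerDual_moduleFinite_of_reducible_of_layerZero_or_classGroupPRank_le`).  `E = W` elliptic over a number
field `K`, `p` odd, `κ` the cyclotomic `ℤ_p`-extension, in which some prime of `K̄` is totally ramified (`K = ℚ`: automatic),
`C ≤ E[p]` a `Γ_K`-stable line.  Statement (A) for `E` at `p` (`∃ γ D, Module.Finite ℤ_[p] D.X`) holds as soon as EACH of the two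
characters passes ONE of its doors:
* side 1 (`χ₁` on `C`): EITHER the layer-zero door — a subfield `K₁ ⊆ K(χ₁,χ₂)` with a generator `P ∈ C ∖ 0` fixed by `Γ_{K₁}` on
  whose class group every tautological eigenfunctional vanishes (no `χ₁`-eigenline in `Cl(K₁) ⊗ 𝔽_p`) and `C^{D_v} = 0` for `v ∣ p` —
  OR bounded `p`-ranks along a cyclotomic `ℤ_p`-extension of `K̄^{ker χ₁}` (classical `μ = 0` of `K(χ₁)`);
* side 2 (`χ₂` on `E[p]/C`): the same with `K₂ = K(P′)`, `P₂ ∈ E[p] ∖ C` fixed modulo `C`, eigen-relations modulo `C`,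
  `(E[p]/C)^{D_v} = 0` — OR bounded `p`-ranks along a cyclotomic `ℤ_p`-extension of `K̄^{ker χ₂}`.
Over `ℚ` (`conjA_of_reducible_of_layerZero_or_classGroupPRank_le_rat`, `conjA_of_reducible_of_eigenHom_subfields_rat`) the
ramification hypothesis is discharged (`ℚ_∞/ℚ` totally ramified at `p`).  On the cell's K8-t′ X3 reducible rows the pure layer-zero
case holds on both sides for every row at `p ∈ {7, 11, 17}` and on 407/591 rows at `p = 5` (seat census, evidence on the item); the
remaining `p = 5` rows pass with side 1 or 2 through the bounded-rank door (Iwasawa 1956 / Fukuda / small rank, rkm g37–g38).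

References: [CoatesSujatha2005] §3 Thm. 3.4, Lemma 3.8, Cor. 3.6; [DeoRaySujatha2023] §3 Thm. 3.8 (c2), (c3), §5 Lemma 5.1;
[Washington1997] §10.1 Thm. 10.4 (proof), §13.1, §13.3; [Wuthrich2014] Lemma 14; [LimSujatha2018] §3.
-/

set_option autoImplicit false

noncomputable section

open scoped Classical Pointwise NumberField nonZeroDivisors
open NumberField IsDedekindDomain Field IntermediateField

namespace Literature.NumberTheory.EllipticCurves.CoatesSujatha2005

open Literature.NumberTheory.IwasawaTheory Literature.NumberTheory.GaloisRepresentations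
  Literature.NumberTheory.NumberFields Literature.NumberTheory.EllipticCurves
  Literature.NumberTheory.EllipticCurves.GreenbergSelmer Literature.NumberTheory.EllipticCurves.ZpExtension
  Literature.NumberTheory.IwasawaTheory.EquivariantUnramifiedHomsZpTowerFinite
  Literature.NumberTheory.EllipticCurves.FineSelmerReducibleIsotypic
  Literature.NumberTheory.EllipticCurves.CoatesSujatha2005.ReducibleLayerZero
-- `_root_`: some import closures declare `Literature.NumberTheory.EllipticCurves.WeierstrassCurve.*`
open _root_.WeierstrassCurve

section General

variable {K : Type} [Field K] [NumberField K] (W : WeierstrassCurve K) [W.IsElliptic] {p : ℕ} [Fact p.Prime]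

/-- **Statement (A) on a reducible row from the per-character DOOR MENU.**  `E = W/K`, `p` odd, `κ` the cyclotomic
`ℤ_p`-extension with a totally ramified prime, `C` a stable line.  Side 1 (`χ₁` on `C`): the layer-zero door L6 (eigen-test on a
subfield `K₁ ∋` the coordinates of a generator `P` of `C`, and `C^{D_v} = 0` above `p`) OR bounded `p`-ranks along a cyclotomic
`ℤ_p`-extension of `K̄^{ker χ₁}`; side 2 (`χ₂` on `E[p]/C`): the same modulo `C`.  Conclusion: the Pontryagin dual of
`Sel₀(E/K_∞)[p^∞]` is finitely generated over `ℤ_p`.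
[cite: CoatesSujatha2005, §3 Thm. 3.4, Lemma 3.8 and Cor. 3.6] [cite: DeoRaySujatha2023, §3 Thm. 3.8 (c2), (c3)]
[cite: Washington1997, §13.3 Lemmas 13.14–13.16 and Prop. 13.23] [cite: LimSujatha2018, §3 (lemma before Prop. 3.2)] -/
theorem fineSelmerDual_moduleFinite_of_reducible_of_layerZero_or_classGroupPRank_le (hp : p ≠ 2)
    (κ : ZpExtension K p) (hκ : κ.IsCyclotomic)
    (hram : ∃ 𝔓' : Ideal (absIntegers (𝓞 K) K), 𝔓'.IsMaximal ∧
      𝔓'.inertia (absoluteGaloisGroup K) ⊔ κ.kerSubgroup = ⊤)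
    (C : AddSubgroup (W.geomTorsion (p : ℤ)))
    (hC : ∀ (σ : absoluteGaloisGroup K) (x : W.geomTorsion (p : ℤ)), x ∈ C → σ • x ∈ C)
    (h1 : C ≠ ⊥) (h2 : C ≠ ⊤)
    (side₁ : haveI : NeZero p := ⟨(Fact.out : p.Prime).ne_zero⟩
      haveI := isGalois_borelField (W := W) hC
      ((∃ (K₁ : IntermediateField K (W.borelField C)) (_ : NumberField K₁) (P : W.geomTorsion (p : ℤ)),
          P ∈ C ∧ P ≠ 0 ∧
          (∀ τ : absoluteGaloisGroup K,
            (∀ x : K₁, absRestrictNormalHom (W.borelField C) τ (x : W.borelField C) = x) → τ • P = P) ∧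
          (∀ μ : Additive (ClassGroup (𝓞 K₁)) →+ ZMod p,
            (∀ (τ : absoluteGaloisGroup K) (σ : K₁ ≃ₐ[K] K₁) (a : ℕ),
              (∀ x : K₁, absRestrictNormalHom (W.borelField C) τ (x : W.borelField C) = ((σ x : K₁) : W.borelField C)) →
              τ • P = a • P →
              ∀ (I J : (Ideal (𝓞 K₁))⁰),
                (J : Ideal (𝓞 K₁)) = (I : Ideal (𝓞 K₁)).map (AmbiguousClass.intAut σ : 𝓞 K₁ →+* 𝓞 K₁) →
                μ (Additive.ofMul (ClassGroup.mk0 J)) = a • μ (Additive.ofMul (ClassGroup.mk0 I))) →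
            μ = 0)) ∧
        (∀ v : HeightOneSpectrum (𝓞 K), ((p : ℕ) : 𝓞 K) ∈ v.asIdeal →
          ∀ w : W.geomTorsion (p : ℤ), w ∈ C → (∀ d ∈ GreenbergSelmer.decomp v, d • w = w) → w = 0)) ∨
      (∃ κ₁ : ZpExtension ↥(fixedField (fixingSubgroup (absoluteGaloisGroup K) (C : Set (W.geomTorsion (p : ℤ)))) :
          IntermediateField K (AlgebraicClosure K)) p, κ₁.IsCyclotomic ∧ ∃ B₁ : ℕ, ∀ m, classGroupPRank κ₁ m ≤ B₁))
    (side₂ : haveI : NeZero p := ⟨(Fact.out : p.Prime).ne_zero⟩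
      haveI := isGalois_borelField (W := W) hC
      ((∃ (K₂ : IntermediateField K (W.borelField C)) (_ : NumberField K₂) (P₂ : W.geomTorsion (p : ℤ)),
          P₂ ∉ C ∧
          (∀ τ : absoluteGaloisGroup K,
            (∀ x : K₂, absRestrictNormalHom (W.borelField C) τ (x : W.borelField C) = x) → τ • P₂ - P₂ ∈ C) ∧
          (∀ μ : Additive (ClassGroup (𝓞 K₂)) →+ ZMod p,
            (∀ (τ : absoluteGaloisGroup K) (σ : K₂ ≃ₐ[K] K₂) (a : ℕ),
              (∀ x : K₂, absRestrictNormalHom (W.borelField C) τ (x : W.borelField C) = ((σ x : K₂) : W.borelField C)) →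
              τ • P₂ - a • P₂ ∈ C →
              ∀ (I J : (Ideal (𝓞 K₂))⁰),
                (J : Ideal (𝓞 K₂)) = (I : Ideal (𝓞 K₂)).map (AmbiguousClass.intAut σ : 𝓞 K₂ →+* 𝓞 K₂) →
                μ (Additive.ofMul (ClassGroup.mk0 J)) = a • μ (Additive.ofMul (ClassGroup.mk0 I))) →
            μ = 0)) ∧
        (∀ v : HeightOneSpectrum (𝓞 K), ((p : ℕ) : 𝓞 K) ∈ v.asIdeal →
          ∀ m : W.geomTorsion (p : ℤ), (∀ d ∈ GreenbergSelmer.decomp v, d • m - m ∈ C) → m ∈ C)) ∨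
      (∃ κ₂ : ZpExtension ↥(fixedField (fixingSubgroup (absoluteGaloisGroup K)
          (Set.range fun y : W.geomTorsion (p : ℤ) => y +ᵥ (C : Set (W.geomTorsion (p : ℤ))))) :
          IntermediateField K (AlgebraicClosure K)) p, κ₂.IsCyclotomic ∧ ∃ B₂ : ℕ, ∀ m, classGroupPRank κ₂ m ≤ B₂)) :
    ∃ (γ : absoluteGaloisGroup K) (D : W.FineSelmerDualData κ γ),
      Module.Finite ℤ_[p] (RestrictScalars ℤ_[p] (IwasawaAlgebra p) D.X) := by
  have hpr : p.Prime := Fact.out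
  haveI : NeZero p := ⟨hpr.ne_zero⟩
  haveI hfinM : Finite (W.geomTorsion (p : ℤ)) := W.finite_geomTorsion_nat (NeZero.ne p)
  have hV : Nat.card (W.geomTorsion (p : ℤ)) = p ^ 2 := W.natCard_geomTorsion_eq_sq_of_charZero hpr
  have hcardC : Nat.card C = p := card_eq_of_ne_bot_of_ne_top hV h1 h2
  have hpM : ∀ m : ↥(W.geomTorsion (p : ℤ)), p • m = 0 := fun m =>
    Subtype.ext (by
      rw [AddSubmonoidClass.coe_nsmul, ZeroMemClass.coe_zero]
      exact AddSubgroup.torsionBy.nsmul_iff.mp m.2)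
  -- the Borel kernel and the two character kernels
  haveI hNn : (W.borelKernel C).Normal := borelKernel_normal hC
  have hNopen : IsOpen (W.borelKernel C : Set (absoluteGaloisGroup K)) := isOpen_borelKernel C
  set G₁ : Subgroup (absoluteGaloisGroup K) :=
    fixingSubgroup (absoluteGaloisGroup K) (C : Set (W.geomTorsion (p : ℤ))) with hG₁
  set G₂ : Subgroup (absoluteGaloisGroup K) := fixingSubgroup (absoluteGaloisGroup K)
    (Set.range fun y : W.geomTorsion (p : ℤ) => y +ᵥ (C : Set (W.geomTorsion (p : ℤ)))) with hG₂
  have hNG₁ : W.borelKernel C ≤ G₁ := borelKernel_le_fixingSubgroup_coe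
  have hNG₂ : W.borelKernel C ≤ G₂ := borelKernel_le_fixingSubgroup_cosets hC
  have hG₁open : IsOpen (G₁ : Set (absoluteGaloisGroup K)) := Subgroup.isOpen_mono hNG₁ hNopen
  have hG₂open : IsOpen (G₂ : Set (absoluteGaloisGroup K)) := Subgroup.isOpen_mono hNG₂ hNopen
  haveI : FiniteDimensional K (W.borelField C) := finiteDimensional_borelField C
  haveI : IsGalois K (W.borelField C) := isGalois_borelField hC
  have hNcard : ¬ p ∣ Nat.card ((fixedField (W.borelKernel C) : IntermediateField K (AlgebraicClosure K)) ≃ₐ[K]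
      (fixedField (W.borelKernel C) : IntermediateField K (AlgebraicClosure K))) := by
    rw [← borelField_def]
    exact not_dvd_card_aut_borelField W C hC h1 h2
  -- the actions on `C` and `E[p]/C` (only to state the g38 count lemma's inputs)
  letI instC : DistribMulAction (absoluteGaloisGroup K) C :=
    { smul := fun σ c ↦ ⟨σ • (c : W.geomTorsion (p : ℤ)), hC σ c c.2⟩
      one_smul := fun c ↦ Subtype.ext (one_smul _ (c : W.geomTorsion (p : ℤ)))
      mul_smul := fun σ τ c ↦ Subtype.ext (mul_smul σ τ (c : W.geomTorsion (p : ℤ)))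
      smul_zero := fun σ ↦ Subtype.ext (smul_zero σ)
      smul_add := fun σ a b ↦ Subtype.ext (smul_add σ (a : W.geomTorsion (p : ℤ)) (b : W.geomTorsion (p : ℤ))) }
  have hsmulC : ∀ (σ : absoluteGaloisGroup K) (c : C),
      ((σ • c : C) : W.geomTorsion (p : ℤ)) = σ • (c : W.geomTorsion (p : ℤ)) := fun σ c ↦ rfl
  have hG₁C : ∀ σ ∈ G₁, ∀ c : C, σ • c = c := fun σ hσ c ↦
    Subtype.ext ((mem_fixingSubgroup_coe_iff σ).1 hσ c c.2)
  have hpC : ∀ c : C, p • c = 0 := fun c ↦ Subtype.ext (by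
    rw [AddSubmonoidClass.coe_nsmul, ZeroMemClass.coe_zero]; exact hpM (c : W.geomTorsion (p : ℤ)))
  haveI : Finite C := inferInstance
  letI instQ : DistribMulAction (absoluteGaloisGroup K) (↥(W.geomTorsion (p : ℤ)) ⧸ C) :=
    { smul := fun σ ↦ QuotientAddGroup.map C C (DistribSMul.toAddMonoidHom (W.geomTorsion (p : ℤ)) σ)
        (fun x hx ↦ AddSubgroup.mem_comap.2 (hC σ x hx))
      one_smul := fun q ↦ QuotientAddGroup.induction_on q fun m ↦ by
        change QuotientAddGroup.map C C (DistribSMul.toAddMonoidHom _ 1) _ (m : _ ⧸ C) = _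
        rw [QuotientAddGroup.map_mk, DistribSMul.toAddMonoidHom_apply, one_smul]
      mul_smul := fun σ τ q ↦ QuotientAddGroup.induction_on q fun m ↦ by
        change QuotientAddGroup.map C C (DistribSMul.toAddMonoidHom _ (σ * τ)) _ (m : _ ⧸ C) =
          QuotientAddGroup.map C C (DistribSMul.toAddMonoidHom _ σ) _
            (QuotientAddGroup.map C C (DistribSMul.toAddMonoidHom _ τ) _ (m : _ ⧸ C))
        rw [QuotientAddGroup.map_mk, QuotientAddGroup.map_mk, QuotientAddGroup.map_mk,
          DistribSMul.toAddMonoidHom_apply, DistribSMul.toAddMonoidHom_apply,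
          DistribSMul.toAddMonoidHom_apply, mul_smul]
      smul_zero := fun σ ↦ map_zero _
      smul_add := fun σ a b ↦ map_add _ a b }
  have hsmulQ : ∀ (σ : absoluteGaloisGroup K) (m : W.geomTorsion (p : ℤ)),
      σ • (m : ↥(W.geomTorsion (p : ℤ)) ⧸ C) = ((σ • m : W.geomTorsion (p : ℤ)) : _ ⧸ C) := fun σ m ↦ rfl
  have hG₂Q : ∀ σ ∈ G₂, ∀ q : ↥(W.geomTorsion (p : ℤ)) ⧸ C, σ • q = q := fun σ hσ q ↦
    QuotientAddGroup.induction_on q fun m ↦ by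
      rw [hsmulQ, QuotientAddGroup.eq_iff_sub_mem]
      exact (mem_fixingSubgroup_cosets_iff hC σ).1 hσ m
  have hpQ : ∀ q : ↥(W.geomTorsion (p : ℤ)) ⧸ C, p • q = 0 := fun q ↦
    QuotientAddGroup.induction_on q fun m ↦ by
      rw [← QuotientAddGroup.mk_nsmul, hpM, QuotientAddGroup.mk_zero]
  haveI : Finite (↥(W.geomTorsion (p : ℤ)) ⧸ C) := inferInstance
  -- side 1: a uniform bound on the `Gal(K̄/K_n)`-equivariant maps `Cl(F_n) → C`
  have hside₁ : ∃ B₁ : ℕ, ∀ n : ℕ,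
      haveI := isGalois_fixedField_inf_layerSubgroup κ (W.borelKernel C) hNopen n
      Nat.card {μ : Additive (ClassGroup (𝓞 (fixedField (W.borelKernel C ⊓ κ.layerSubgroup n) :
          IntermediateField K (AlgebraicClosure K)))) →+ C //
        ∀ γ ∈ κ.layerSubgroup n, ∀ c,
          ((μ (Additive.ofMul (ClassGroup.mulEquiv (AmbiguousClass.intAut
            (absRestrictNormalHom (fixedField (W.borelKernel C ⊓ κ.layerSubgroup n) :
              IntermediateField K (AlgebraicClosure K)) γ)) c)) : C) : W.geomTorsion (p : ℤ)) =
            γ • ((μ (Additive.ofMul c) : C) : W.geomTorsion (p : ℤ))} ≤ B₁ := by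
    rcases side₁ with ⟨⟨K₁, hK₁, P, hPC, hP0, hPK, hEig⟩, hD⟩ | ⟨κ₁, hκ₁, B₁, hB₁⟩
    · exact ⟨1, fun n => natCard_equivariantHom_line_layer_le_one W hp C hC h1 h2 K₁ P hPC hP0 hPK hEig hD κ hram n⟩
    · refine ⟨Nat.card C ^ (p ^ B₁), fun n => ?_⟩
      haveI := isGalois_fixedField_inf_layerSubgroup κ (W.borelKernel C) hNopen n
      refine le_trans (le_of_eq (Nat.card_congr (Equiv.subtypeEquivRight fun μ => ?_)))
        (natCard_equivariantHom_layer_le_of_classGroupPRank_le κ hκ (W.borelKernel C) G₁ hNG₁ hNopen hG₁open hNcard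
          hpC hG₁C B₁ ⟨κ₁, hκ₁, hB₁⟩ n)
      refine forall_congr' fun γ => forall_congr' fun _ => forall_congr' fun c => ?_
      exact ⟨fun h => Subtype.ext (by rw [hsmulC]; exact h), fun h => by rw [← hsmulC]; exact congrArg Subtype.val h⟩
  -- side 2: a uniform bound on the maps `Cl(F_n) → E[p]/C`
  have hside₂ : ∃ B₂ : ℕ, ∀ n : ℕ,
      haveI := isGalois_fixedField_inf_layerSubgroup κ (W.borelKernel C) hNopen n
      Nat.card {μ : Additive (ClassGroup (𝓞 (fixedField (W.borelKernel C ⊓ κ.layerSubgroup n) :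
          IntermediateField K (AlgebraicClosure K)))) →+ (↥(W.geomTorsion (p : ℤ)) ⧸ C) //
        ∀ γ ∈ κ.layerSubgroup n, ∀ c, ∀ m : W.geomTorsion (p : ℤ),
          μ (Additive.ofMul c) = (m : ↥(W.geomTorsion (p : ℤ)) ⧸ C) →
          μ (Additive.ofMul (ClassGroup.mulEquiv (AmbiguousClass.intAut
            (absRestrictNormalHom (fixedField (W.borelKernel C ⊓ κ.layerSubgroup n) :
              IntermediateField K (AlgebraicClosure K)) γ)) c)) =
            ((γ • m : W.geomTorsion (p : ℤ)) : _ ⧸ C)} ≤ B₂ := by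
    rcases side₂ with ⟨⟨K₂, hK₂, P₂, hP₂, hPK, hEig⟩, hD⟩ | ⟨κ₂, hκ₂, B₂, hB₂⟩
    · exact ⟨1, fun n => natCard_equivariantHom_quotient_layer_le_one W hp C hC h1 h2 K₂ P₂ hP₂ hPK hEig hD κ hram n⟩
    · refine ⟨Nat.card (↥(W.geomTorsion (p : ℤ)) ⧸ C) ^ (p ^ B₂), fun n => ?_⟩
      haveI := isGalois_fixedField_inf_layerSubgroup κ (W.borelKernel C) hNopen n
      refine le_trans (le_of_eq (Nat.card_congr (Equiv.subtypeEquivRight fun μ => ?_)))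
        (natCard_equivariantHom_layer_le_of_classGroupPRank_le κ hκ (W.borelKernel C) G₂ hNG₂ hNopen hG₂open hNcard
          hpQ hG₂Q B₂ ⟨κ₂, hκ₂, hB₂⟩ n)
      refine forall_congr' fun γ => forall_congr' fun _ => forall_congr' fun c => ?_
      constructor
      · intro h
        obtain ⟨m, hm⟩ := QuotientAddGroup.mk_surjective (μ (Additive.ofMul c))
        rw [h m hm.symm, ← hm, hsmulQ]
      · intro h m hm
        rw [h, hm, hsmulQ]
  obtain ⟨B₁, hB₁⟩ := hside₁
  obtain ⟨B₂, hB₂⟩ := hside₂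
  rw [LimSujatha2018.fineSelmerDual_moduleFinite_iff_finite_fineSelmerInfty_torsion W hp κ hκ]
  exact fineSelmerInfty_torsion_finite_of_reducible_of_natCard_le W hp κ hκ C hC B₁ B₂ hB₁ hB₂

end General

/-! ## Over `ℚ`: the ramification hypothesis is automatic (`ℚ_∞/ℚ` is totally ramified at `p`) -/

section Rat

variable (W : WeierstrassCurve ℚ) [W.IsElliptic] {p : ℕ} [Fact p.Prime]

/-- **Statement (A) on a reducible row over `ℚ` from the per-character door menu** (layer-zero door L6 ∨ bounded `p`-ranks of
`ℚ(χ_i)`), `κ` the cyclotomic `ℤ_p`-extension of `ℚ`: `fineSelmerDual_moduleFinite_of_reducible_of_layerZero_or_classGroupPRank_le`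
with its ramification hypothesis discharged by `EquivariantIwasawaLemma.exists_isMaximal_inertia_sup_kerSubgroup_eq_top_of_isCyclotomic`.
Per row: side `i` passes its layer-zero door iff `p` is not totally split in `ℚ(χ_i)` and the `χ_i`-eigenspace of a generator of
`Gal(ℚ(χ_i)/ℚ)` on `Cl(ℚ(χ_i)) ⊗ 𝔽_p` is zero (`ℚ(χ₁) = ℚ(P)`, `ℚ(χ₂) = ℚ(P′)`).
[cite: CoatesSujatha2005, §3 Thm. 3.4, Lemma 3.8 and Cor. 3.6] [cite: DeoRaySujatha2023, §3 Thm. 3.8 (c2), (c3)]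
[cite: Washington1997, §13.1 (ℚ_∞/ℚ totally ramified at p), §13.3 Lemmas 13.14–13.16] -/
theorem conjA_of_reducible_of_layerZero_or_classGroupPRank_le_rat (hp : p ≠ 2)
    (κ : ZpExtension ℚ p) (hκ : κ.IsCyclotomic)
    (C : AddSubgroup (W.geomTorsion (p : ℤ)))
    (hC : ∀ (σ : absoluteGaloisGroup ℚ) (x : W.geomTorsion (p : ℤ)), x ∈ C → σ • x ∈ C)
    (h1 : C ≠ ⊥) (h2 : C ≠ ⊤)
    (side₁ : haveI : NeZero p := ⟨(Fact.out : p.Prime).ne_zero⟩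
      haveI := isGalois_borelField (W := W) hC
      ((∃ (K₁ : IntermediateField ℚ (W.borelField C)) (_ : NumberField K₁) (P : W.geomTorsion (p : ℤ)),
          P ∈ C ∧ P ≠ 0 ∧
          (∀ τ : absoluteGaloisGroup ℚ,
            (∀ x : K₁, absRestrictNormalHom (W.borelField C) τ (x : W.borelField C) = x) → τ • P = P) ∧
          (∀ μ : Additive (ClassGroup (𝓞 K₁)) →+ ZMod p,
            (∀ (τ : absoluteGaloisGroup ℚ) (σ : K₁ ≃ₐ[ℚ] K₁) (a : ℕ),
              (∀ x : K₁, absRestrictNormalHom (W.borelField C) τ (x : W.borelField C) = ((σ x : K₁) : W.borelField C)) →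
              τ • P = a • P →
              ∀ (I J : (Ideal (𝓞 K₁))⁰),
                (J : Ideal (𝓞 K₁)) = (I : Ideal (𝓞 K₁)).map (AmbiguousClass.intAut σ : 𝓞 K₁ →+* 𝓞 K₁) →
                μ (Additive.ofMul (ClassGroup.mk0 J)) = a • μ (Additive.ofMul (ClassGroup.mk0 I))) →
            μ = 0)) ∧
        (∀ v : HeightOneSpectrum (𝓞 ℚ), ((p : ℕ) : 𝓞 ℚ) ∈ v.asIdeal →
          ∀ w : W.geomTorsion (p : ℤ), w ∈ C → (∀ d ∈ GreenbergSelmer.decomp v, d • w = w) → w = 0)) ∨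
      (∃ κ₁ : ZpExtension ↥(fixedField (fixingSubgroup (absoluteGaloisGroup ℚ) (C : Set (W.geomTorsion (p : ℤ)))) :
          IntermediateField ℚ (AlgebraicClosure ℚ)) p, κ₁.IsCyclotomic ∧ ∃ B₁ : ℕ, ∀ m, classGroupPRank κ₁ m ≤ B₁))
    (side₂ : haveI : NeZero p := ⟨(Fact.out : p.Prime).ne_zero⟩
      haveI := isGalois_borelField (W := W) hC
      ((∃ (K₂ : IntermediateField ℚ (W.borelField C)) (_ : NumberField K₂) (P₂ : W.geomTorsion (p : ℤ)),
          P₂ ∉ C ∧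
          (∀ τ : absoluteGaloisGroup ℚ,
            (∀ x : K₂, absRestrictNormalHom (W.borelField C) τ (x : W.borelField C) = x) → τ • P₂ - P₂ ∈ C) ∧
          (∀ μ : Additive (ClassGroup (𝓞 K₂)) →+ ZMod p,
            (∀ (τ : absoluteGaloisGroup ℚ) (σ : K₂ ≃ₐ[ℚ] K₂) (a : ℕ),
              (∀ x : K₂, absRestrictNormalHom (W.borelField C) τ (x : W.borelField C) = ((σ x : K₂) : W.borelField C)) →
              τ • P₂ - a • P₂ ∈ C →
              ∀ (I J : (Ideal (𝓞 K₂))⁰),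
                (J : Ideal (𝓞 K₂)) = (I : Ideal (𝓞 K₂)).map (AmbiguousClass.intAut σ : 𝓞 K₂ →+* 𝓞 K₂) →
                μ (Additive.ofMul (ClassGroup.mk0 J)) = a • μ (Additive.ofMul (ClassGroup.mk0 I))) →
            μ = 0)) ∧
        (∀ v : HeightOneSpectrum (𝓞 ℚ), ((p : ℕ) : 𝓞 ℚ) ∈ v.asIdeal →
          ∀ m : W.geomTorsion (p : ℤ), (∀ d ∈ GreenbergSelmer.decomp v, d • m - m ∈ C) → m ∈ C)) ∨
      (∃ κ₂ : ZpExtension ↥(fixedField (fixingSubgroup (absoluteGaloisGroup ℚ)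
          (Set.range fun y : W.geomTorsion (p : ℤ) => y +ᵥ (C : Set (W.geomTorsion (p : ℤ))))) :
          IntermediateField ℚ (AlgebraicClosure ℚ)) p, κ₂.IsCyclotomic ∧ ∃ B₂ : ℕ, ∀ m, classGroupPRank κ₂ m ≤ B₂)) :
    ∃ (γ : absoluteGaloisGroup ℚ) (D : W.FineSelmerDualData κ γ),
      Module.Finite ℤ_[p] (RestrictScalars ℤ_[p] (IwasawaAlgebra p) D.X) :=
  fineSelmerDual_moduleFinite_of_reducible_of_layerZero_or_classGroupPRank_le W hp κ hκ
    (EquivariantIwasawaLemma.exists_isMaximal_inertia_sup_kerSubgroup_eq_top_of_isCyclotomic hκ) C hC h1 h2 side₁ side₂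

/-- **The pure LAYER-ZERO door on a reducible row over `ℚ`** (both characters through door L6): `E/ℚ`, `p` odd, `C` a stable
line, subfields `K₁, K₂ ⊆ ℚ(χ₁,χ₂)` with generators `P ∈ C ∖ 0` fixed by `Γ_{K₁}` and `P₂ ∈ E[p] ∖ C` fixed modulo `C` by `Γ_{K₂}`
(`K₁ = ℚ(P)`, `K₂ = ℚ(P′)`), the two eigen-tests (no `χ₁`-eigenline in `Cl(K₁) ⊗ 𝔽_p`, no `χ₂`-eigenline in `Cl(K₂) ⊗ 𝔽_p`) and the
two decomposition conditions at `p` (`C^{D_p} = 0`, `(E[p]/C)^{D_p} = 0`, i.e. `p` not totally split in `ℚ(χ₁)`, `ℚ(χ₂)`) ⟹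
statement (A) for `E` at `p` over `ℚ_cyc` — with NO class group above layer `0` and NO named fact.
[cite: CoatesSujatha2005, §3 Thm. 3.4, Lemma 3.8 and Cor. 3.6] [cite: DeoRaySujatha2023, §3 Thm. 3.8 (c2), (c3) and §5 Lemma 5.1]
[cite: Washington1997, §13.3 Lemmas 13.14–13.16 and §10.1 Thm. 10.4 (proof)] -/
theorem conjA_of_reducible_of_eigenHom_subfields_rat (hp : p ≠ 2)
    (κ : ZpExtension ℚ p) (hκ : κ.IsCyclotomic)
    (C : AddSubgroup (W.geomTorsion (p : ℤ)))
    (hC : ∀ (σ : absoluteGaloisGroup ℚ) (x : W.geomTorsion (p : ℤ)), x ∈ C → σ • x ∈ C)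
    (h1 : C ≠ ⊥) (h2 : C ≠ ⊤)
    (K₁ : IntermediateField ℚ (W.borelField C)) [NumberField K₁]
    (P : W.geomTorsion (p : ℤ)) (hPC : P ∈ C) (hP0 : P ≠ 0)
    (hPK₁ : haveI : NeZero p := ⟨(Fact.out : p.Prime).ne_zero⟩
      haveI := isGalois_borelField (W := W) hC
      ∀ τ : absoluteGaloisGroup ℚ,
        (∀ x : K₁, absRestrictNormalHom (W.borelField C) τ (x : W.borelField C) = x) → τ • P = P)
    (hEig₁ : haveI : NeZero p := ⟨(Fact.out : p.Prime).ne_zero⟩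
      haveI := isGalois_borelField (W := W) hC
      ∀ μ : Additive (ClassGroup (𝓞 K₁)) →+ ZMod p,
        (∀ (τ : absoluteGaloisGroup ℚ) (σ : K₁ ≃ₐ[ℚ] K₁) (a : ℕ),
          (∀ x : K₁, absRestrictNormalHom (W.borelField C) τ (x : W.borelField C) = ((σ x : K₁) : W.borelField C)) →
          τ • P = a • P →
          ∀ (I J : (Ideal (𝓞 K₁))⁰),
            (J : Ideal (𝓞 K₁)) = (I : Ideal (𝓞 K₁)).map (AmbiguousClass.intAut σ : 𝓞 K₁ →+* 𝓞 K₁) →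
            μ (Additive.ofMul (ClassGroup.mk0 J)) = a • μ (Additive.ofMul (ClassGroup.mk0 I))) →
        μ = 0)
    (hD₁ : ∀ v : HeightOneSpectrum (𝓞 ℚ), ((p : ℕ) : 𝓞 ℚ) ∈ v.asIdeal →
      ∀ w : W.geomTorsion (p : ℤ), w ∈ C → (∀ d ∈ GreenbergSelmer.decomp v, d • w = w) → w = 0)
    (K₂ : IntermediateField ℚ (W.borelField C)) [NumberField K₂]
    (P₂ : W.geomTorsion (p : ℤ)) (hP₂ : P₂ ∉ C)
    (hPK₂ : haveI : NeZero p := ⟨(Fact.out : p.Prime).ne_zero⟩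
      haveI := isGalois_borelField (W := W) hC
      ∀ τ : absoluteGaloisGroup ℚ,
        (∀ x : K₂, absRestrictNormalHom (W.borelField C) τ (x : W.borelField C) = x) → τ • P₂ - P₂ ∈ C)
    (hEig₂ : haveI : NeZero p := ⟨(Fact.out : p.Prime).ne_zero⟩
      haveI := isGalois_borelField (W := W) hC
      ∀ μ : Additive (ClassGroup (𝓞 K₂)) →+ ZMod p,
        (∀ (τ : absoluteGaloisGroup ℚ) (σ : K₂ ≃ₐ[ℚ] K₂) (a : ℕ),
          (∀ x : K₂, absRestrictNormalHom (W.borelField C) τ (x : W.borelField C) = ((σ x : K₂) : W.borelField C)) →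
          τ • P₂ - a • P₂ ∈ C →
          ∀ (I J : (Ideal (𝓞 K₂))⁰),
            (J : Ideal (𝓞 K₂)) = (I : Ideal (𝓞 K₂)).map (AmbiguousClass.intAut σ : 𝓞 K₂ →+* 𝓞 K₂) →
            μ (Additive.ofMul (ClassGroup.mk0 J)) = a • μ (Additive.ofMul (ClassGroup.mk0 I))) →
        μ = 0)
    (hD₂ : ∀ v : HeightOneSpectrum (𝓞 ℚ), ((p : ℕ) : 𝓞 ℚ) ∈ v.asIdeal →
      ∀ m : W.geomTorsion (p : ℤ), (∀ d ∈ GreenbergSelmer.decomp v, d • m - m ∈ C) → m ∈ C) :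
    ∃ (γ : absoluteGaloisGroup ℚ) (D : W.FineSelmerDualData κ γ),
      Module.Finite ℤ_[p] (RestrictScalars ℤ_[p] (IwasawaAlgebra p) D.X) :=
  conjA_of_reducible_of_layerZero_or_classGroupPRank_le_rat W hp κ hκ C hC h1 h2
    (Or.inl ⟨⟨K₁, inferInstance, P, hPC, hP0, hPK₁, hEig₁⟩, hD₁⟩)
    (Or.inl ⟨⟨K₂, inferInstance, P₂, hP₂, hPK₂, hEig₂⟩, hD₂⟩)

end Rat

/-! ## APPEND (same seat, g39): any number field — per side, layer-zero door OR classical `μ = 0` of `K̄^{ker χ_i}`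

(The `μ = 0` disjunct is converted to the bounded-`p`-rank disjunct of
`fineSelmerDual_moduleFinite_of_reducible_of_layerZero_or_classGroupPRank_le` along a shifted base change of `κ`.) -/

section GeneralMu

variable {K : Type} [Field K] [NumberField K] (W : WeierstrassCurve K) [W.IsElliptic] {p : ℕ} [Fact p.Prime]

/-- **(A) on a reducible row, per side: the layer-zero door OR classical `μ = 0` of `K̄^{ker χ_i}`** (`K` a number field, `p` odd,
`κ` cyclotomic with a totally ramified prime; `μ = 0` bounds the `p`-ranks along a shifted base change of `κ`, Washington Prop. 13.23).
[cite: CoatesSujatha2005, §3 Thm. 3.4, Lemma 3.8 and Cor. 3.6] [cite: DeoRaySujatha2023, §3 Thm. 3.8 (c2), (c3)]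
[cite: Washington1997, §13.3 Lemmas 13.14–13.16 and Prop. 13.23] -/
theorem fineSelmerDual_moduleFinite_of_reducible_of_layerZero_or_classicalMuVanishes (hp : p ≠ 2)
    (κ : ZpExtension K p) (hκ : κ.IsCyclotomic)
    (hram : ∃ 𝔓' : Ideal (absIntegers (𝓞 K) K), 𝔓'.IsMaximal ∧
      𝔓'.inertia (absoluteGaloisGroup K) ⊔ κ.kerSubgroup = ⊤)
    (C : AddSubgroup (W.geomTorsion (p : ℤ)))
    (hC : ∀ (σ : absoluteGaloisGroup K) (x : W.geomTorsion (p : ℤ)), x ∈ C → σ • x ∈ C)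
    (h1 : C ≠ ⊥) (h2 : C ≠ ⊤)
    (side₁ : haveI : NeZero p := ⟨(Fact.out : p.Prime).ne_zero⟩
      haveI := isGalois_borelField (W := W) hC
      ((∃ (K₁ : IntermediateField K (W.borelField C)) (_ : NumberField K₁) (P : W.geomTorsion (p : ℤ)),
          P ∈ C ∧ P ≠ 0 ∧
          (∀ τ : absoluteGaloisGroup K,
            (∀ x : K₁, absRestrictNormalHom (W.borelField C) τ (x : W.borelField C) = x) → τ • P = P) ∧
          (∀ μ : Additive (ClassGroup (𝓞 K₁)) →+ ZMod p,
            (∀ (τ : absoluteGaloisGroup K) (σ : K₁ ≃ₐ[K] K₁) (a : ℕ),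
              (∀ x : K₁, absRestrictNormalHom (W.borelField C) τ (x : W.borelField C) = ((σ x : K₁) : W.borelField C)) →
              τ • P = a • P →
              ∀ (I J : (Ideal (𝓞 K₁))⁰),
                (J : Ideal (𝓞 K₁)) = (I : Ideal (𝓞 K₁)).map (AmbiguousClass.intAut σ : 𝓞 K₁ →+* 𝓞 K₁) →
                μ (Additive.ofMul (ClassGroup.mk0 J)) = a • μ (Additive.ofMul (ClassGroup.mk0 I))) →
            μ = 0)) ∧
        (∀ v : HeightOneSpectrum (𝓞 K), ((p : ℕ) : 𝓞 K) ∈ v.asIdeal →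
          ∀ w : W.geomTorsion (p : ℤ), w ∈ C → (∀ d ∈ GreenbergSelmer.decomp v, d • w = w) → w = 0)) ∨
      (∀ κ₁ : ZpExtension ↥(fixedField (fixingSubgroup (absoluteGaloisGroup K) (C : Set (W.geomTorsion (p : ℤ)))) :
          IntermediateField K (AlgebraicClosure K)) p, κ₁.IsCyclotomic → ClassicalMuVanishes κ₁))
    (side₂ : haveI : NeZero p := ⟨(Fact.out : p.Prime).ne_zero⟩
      haveI := isGalois_borelField (W := W) hC
      ((∃ (K₂ : IntermediateField K (W.borelField C)) (_ : NumberField K₂) (P₂ : W.geomTorsion (p : ℤ)),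
          P₂ ∉ C ∧
          (∀ τ : absoluteGaloisGroup K,
            (∀ x : K₂, absRestrictNormalHom (W.borelField C) τ (x : W.borelField C) = x) → τ • P₂ - P₂ ∈ C) ∧
          (∀ μ : Additive (ClassGroup (𝓞 K₂)) →+ ZMod p,
            (∀ (τ : absoluteGaloisGroup K) (σ : K₂ ≃ₐ[K] K₂) (a : ℕ),
              (∀ x : K₂, absRestrictNormalHom (W.borelField C) τ (x : W.borelField C) = ((σ x : K₂) : W.borelField C)) →
              τ • P₂ - a • P₂ ∈ C →
              ∀ (I J : (Ideal (𝓞 K₂))⁰),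
                (J : Ideal (𝓞 K₂)) = (I : Ideal (𝓞 K₂)).map (AmbiguousClass.intAut σ : 𝓞 K₂ →+* 𝓞 K₂) →
                μ (Additive.ofMul (ClassGroup.mk0 J)) = a • μ (Additive.ofMul (ClassGroup.mk0 I))) →
            μ = 0)) ∧
        (∀ v : HeightOneSpectrum (𝓞 K), ((p : ℕ) : 𝓞 K) ∈ v.asIdeal →
          ∀ m : W.geomTorsion (p : ℤ), (∀ d ∈ GreenbergSelmer.decomp v, d • m - m ∈ C) → m ∈ C)) ∨
      (∀ κ₂ : ZpExtension ↥(fixedField (fixingSubgroup (absoluteGaloisGroup K)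
          (Set.range fun y : W.geomTorsion (p : ℤ) => y +ᵥ (C : Set (W.geomTorsion (p : ℤ))))) :
          IntermediateField K (AlgebraicClosure K)) p, κ₂.IsCyclotomic → ClassicalMuVanishes κ₂)) :
    ∃ (γ : absoluteGaloisGroup K) (D : W.FineSelmerDualData κ γ),
      Module.Finite ℤ_[p] (RestrictScalars ℤ_[p] (IwasawaAlgebra p) D.X) := by
  have hpr : p.Prime := Fact.out
  haveI : NeZero p := ⟨hpr.ne_zero⟩
  haveI hfinM : Finite (W.geomTorsion (p : ℤ)) := W.finite_geomTorsion_nat (NeZero.ne p)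
  -- the two character kernels are open, so their fixed fields are number fields carrying cyclotomic `ℤ_p`-extensions
  have hNopen : IsOpen (W.borelKernel C : Set (absoluteGaloisGroup K)) := isOpen_borelKernel C
  have hG₁open : IsOpen ((fixingSubgroup (absoluteGaloisGroup K) (C : Set (W.geomTorsion (p : ℤ)))) : Set (absoluteGaloisGroup K)) :=
    Subgroup.isOpen_mono borelKernel_le_fixingSubgroup_coe hNopen
  have hG₂open : IsOpen ((fixingSubgroup (absoluteGaloisGroup K)
    (Set.range fun y : W.geomTorsion (p : ℤ) => y +ᵥ (C : Set (W.geomTorsion (p : ℤ))))) : Set (absoluteGaloisGroup K)) :=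
    Subgroup.isOpen_mono (borelKernel_le_fixingSubgroup_cosets hC) hNopen
  haveI : FiniteDimensional K (fixedField (fixingSubgroup (absoluteGaloisGroup K) (C : Set (W.geomTorsion (p : ℤ)))) : IntermediateField K (AlgebraicClosure K)) :=
    finiteDimensional_fixedField_of_isOpen _ hG₁open
  haveI : NumberField (fixedField (fixingSubgroup (absoluteGaloisGroup K) (C : Set (W.geomTorsion (p : ℤ)))) : IntermediateField K (AlgebraicClosure K)) :=
    NumberField.of_module_finite K _
  haveI : FiniteDimensional K (fixedField (fixingSubgroup (absoluteGaloisGroup K)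
    (Set.range fun y : W.geomTorsion (p : ℤ) => y +ᵥ (C : Set (W.geomTorsion (p : ℤ))))) : IntermediateField K (AlgebraicClosure K)) :=
    finiteDimensional_fixedField_of_isOpen _ hG₂open
  haveI : NumberField (fixedField (fixingSubgroup (absoluteGaloisGroup K)
    (Set.range fun y : W.geomTorsion (p : ℤ) => y +ᵥ (C : Set (W.geomTorsion (p : ℤ))))) : IntermediateField K (AlgebraicClosure K)) :=
    NumberField.of_module_finite K _
  refine fineSelmerDual_moduleFinite_of_reducible_of_layerZero_or_classGroupPRank_le W hp κ hκ hram C hC h1 h2 ?_ ?_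
  · rcases side₁ with h | hμ₁
    · exact Or.inl h
    · refine Or.inr ?_
      obtain ⟨a₁, κ₁, hs₁⟩ := exists_zpExtension_shift κ
        ↥(fixedField (fixingSubgroup (absoluteGaloisGroup K) (C : Set (W.geomTorsion (p : ℤ)))) : IntermediateField K (AlgebraicClosure K))
      have hκ₁ : κ₁.IsCyclotomic := isCyclotomic_of_shift κ _ κ₁ hs₁ hκ
      obtain ⟨B₁, hB₁⟩ := exists_forall_classGroupPRank_le_of_classicalMuVanishes κ₁ (hμ₁ κ₁ hκ₁)
      exact ⟨κ₁, hκ₁, B₁, hB₁⟩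
  · rcases side₂ with h | hμ₂
    · exact Or.inl h
    · refine Or.inr ?_
      obtain ⟨a₂, κ₂, hs₂⟩ := exists_zpExtension_shift κ
        ↥(fixedField (fixingSubgroup (absoluteGaloisGroup K)
    (Set.range fun y : W.geomTorsion (p : ℤ) => y +ᵥ (C : Set (W.geomTorsion (p : ℤ))))) : IntermediateField K (AlgebraicClosure K))
      have hκ₂ : κ₂.IsCyclotomic := isCyclotomic_of_shift κ _ κ₂ hs₂ hκ
      obtain ⟨B₂, hB₂⟩ := exists_forall_classGroupPRank_le_of_classicalMuVanishes κ₂ (hμ₂ κ₂ hκ₂)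
      exact ⟨κ₂, hκ₂, B₂, hB₂⟩

end GeneralMu


end Literature.NumberTheory.EllipticCurves.CoatesSujatha2005

end
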